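import Summits.NavierStokesRegularity.NavierStokesRegularity.Theorems.ExtremiserTransienceLocalMaximiserThickGoodCentre
import Summits.NavierStokesRegularity.NavierStokesRegularity.Theorems.ExtremiserTransienceLocalMaximiserGainLimit
import HarnessLib

/-!
# Route `ExtremiserTransience`, crux `NearExtremalTransiencePerFlow` (stmt-NavierStokesRegularity-26567),
# LINE g9-1 «local maximiser» (ideator ns-idea-10 g9): L1 `LocalSlack` (Theorems-side port) and the unconditional `Selection`

Theorems-side PORT, essentially verbatim, of the author's in-file proof of L1 (`localSlack_holds`, REV 1.2 of
`Cruxes/NearExtremalTransience/Lines/local_maximiser.lean`, planner ns-idea-10 g9 — all credit for the argument is the author's;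
a `Cruxes/` file is not importable from `Theorems/`, hence the port), over the texts of record
`…Theorems.ExtremiserTransienceLocalMaximiserDefs`; together with the landed L2 (`thickGoodCentre_holds`) it yields the
UNCONDITIONAL thick-good-centre selection `selection_holds : Selection` — exactly the hypothesis of the line's L3 `Extraction`.

* `lsi_abstract` — the tangent-plane (AM–GM) inequality for the concave `√(ZW)`: universality `J' ≤ κM√Z'√W'` and
  near-extremality `(κ−ε)M√Z√W ≤ J` give `J' − J − (κM/2)(λ⁻¹(Z'−Z) + λ(W'−W)) ≤ εM√Z√W`, `λ = √(Z/W)`;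
* germ-locality and integrability of the gain integrand (the densities' germ lemmas `sd_congr_nhds / zd_congr_nhds / wd_congr_nhds`,
  `gainIntegrand`, `gainIntegrand_eq_zero`, `continuous_gainIntegrand` are REUSED from ns-net-p2 g11's landed
  `…Theorems.ExtremiserTransienceLocalMaximiserGainLimit`, not restated);
* `localSlack_holds : LocalSlack` — joint field `v + Σφᵢ` admissible (`KStar.admissible_add_smul`, height `M` by disjointness
  of the supports), additivity of the gains, universality of `κ⋆` (`DepletionLadder.sharpDepletion_is_universal`), `lsi_abstract`;
* `selection_holds : Selection` (`selection_of_localSlack localSlack_holds`).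

The line's `def gi` is the landed `gainIntegrand` of `…LocalMaximiserGainLimit` (no new definitions in this proof file).
Landed `--supports stmt-NavierStokesRegularity-26567` by prover seat `ns-net-p1` (g14).  HONEST FRAMING: lemmas about ONE
admissible vector field; nothing about Navier–Stokes regularity or blow-up is proved here; no summit is proved by a line.
-/

noncomputable section

open scoped Topology InnerProductSpace RealInnerProductSpace ENNReal ContDiff
open MeasureTheory Filter Set Metric
open Literature.Analysis.FluidPDE
open Summit.NavierStokesRegularity.NavierStokesRegularity.Theorems.DepletionLadder
open Summit.NavierStokesRegularity.NavierStokesRegularity.Theorems.DepletionLadder.KStar.HalfSpace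
open Summit.NavierStokesRegularity.NavierStokesRegularity.Theorems.DepletionLadder.KStar.BangBang

namespace Summit.NavierStokesRegularity.NavierStokesRegularity.Theorems.NearExtremalTransiencePerFlow.LocalMaximiser

-- the problem directory repeats the summit name (`NavierStokesRegularity/NavierStokesRegularity`)
set_option linter.dupNamespace false

/-! ## 1. The LSI engine -/

/-- **LSI ENGINE (tangent plane of the concave `√(ZW)` = AM–GM).** With `u = √Z`, `w = √W`, `p = √Z'`, `q = √W'`
(perturbed budgets), universality `J' ≤ κM·p·q` and near-extremality `(κ−ε)M·u·w ≤ J` give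
`J' − J − (κM/2)((w/u)(p²−u²) + (u/w)(q²−w²)) ≤ εM·u·w`; note `w/u = λ⁻¹`, `u/w = λ`.  (The line's `lsi_abstract`, author
ns-idea-10 g9, verbatim but for the two unused sign hypotheses on `p, q`, dropped.) [folklore] -/
theorem lsi_abstract {u w p q J J' κ M ε : ℝ} (hu : 0 < u) (hw : 0 < w)
    (hκM : 0 ≤ κ * M) (huniv : J' ≤ κ * M * p * q) (hext : (κ - ε) * M * u * w ≤ J) :
    J' - J - κ * M / 2 * ((w / u) * (p ^ 2 - u ^ 2) + (u / w) * (q ^ 2 - w ^ 2)) ≤ ε * M * u * w := by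
  have huw : 0 < u * w := mul_pos hu hw
  -- AM–GM: `2uw·pq ≤ w²p² + u²q²`
  have hamgm : κ * M * (2 * (u * w) * (p * q)) ≤ κ * M * (w ^ 2 * p ^ 2 + u ^ 2 * q ^ 2) :=
    mul_le_mul_of_nonneg_left (by nlinarith [sq_nonneg (w * p - u * q)]) hκM
  have hrew : (w / u) * (p ^ 2 - u ^ 2) + (u / w) * (q ^ 2 - w ^ 2) =
      (w ^ 2 * p ^ 2 + u ^ 2 * q ^ 2 - 2 * (u * w) * (u * w)) / (u * w) := by
    field_simp
    ring
  rw [hrew]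
  have key : κ * M / 2 * ((w ^ 2 * p ^ 2 + u ^ 2 * q ^ 2 - 2 * (u * w) * (u * w)) / (u * w)) ≥
      κ * M * (p * q) - κ * M * (u * w) := by
    rw [ge_iff_le, ← sub_nonneg]
    have h1 : κ * M / 2 * ((w ^ 2 * p ^ 2 + u ^ 2 * q ^ 2 - 2 * (u * w) * (u * w)) / (u * w)) -
        (κ * M * (p * q) - κ * M * (u * w)) =
        (κ * M * (w ^ 2 * p ^ 2 + u ^ 2 * q ^ 2) - κ * M * (2 * (u * w) * (p * q))) / (2 * (u * w)) := by
      field_simp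
      ring
    rw [h1]
    exact div_nonneg (by linarith) (by positivity)
  have hJ' : J' ≤ κ * M * (p * q) := by linarith [huniv, show κ * M * p * q = κ * M * (p * q) by ring]
  have hJ : κ * M * (u * w) - ε * M * u * w ≤ J := by nlinarith [hext]
  linarith

/-! ## 2. Germ-locality and integrability of the gain integrand (over the landed `gainIntegrand`) -/

/-- Germs of `V + φ` determine the gain integrand: if `V + φ₁` and `V + φ₂` agree near `x`, the two gain integrands agree at `x`
(from the landed germ lemmas `sd_congr_nhds`, `zd_congr_nhds`, `wd_congr_nhds`). [folklore] -/
theorem gainIntegrand_congr {κ μ : ℝ} {V φ₁ φ₂ : E3 → E3} {x : E3} (h : (V + φ₁) =ᶠ[𝓝 x] (V + φ₂)) :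
    gainIntegrand κ μ V φ₁ x = gainIntegrand κ μ V φ₂ x := by
  unfold gainIntegrand
  rw [sd_congr_nhds h, zd_congr_nhds h, wd_congr_nhds h]

/-- The gain integrand of a smooth, compactly supported perturbation is integrable (continuous with compact support). [folklore] -/
theorem integrable_gainIntegrand {κ μ : ℝ} {V φ : E3 → E3} (hV : ContDiff ℝ (⊤ : ℕ∞) V)
    (hφ : ContDiff ℝ (⊤ : ℕ∞) φ) (hφc : HasCompactSupport φ) : Integrable (gainIntegrand κ μ V φ) :=
  (continuous_gainIntegrand hV hφ).integrable_of_hasCompactSupport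
    (HasCompactSupport.intro hφc fun _ hx => gainIntegrand_eq_zero hx)

/-! ## 3. L1 proved (port of the author's `localSlack_holds`) -/

/-- **L1 `LocalSlack` holds**: for admissible `v` of height `M`, positive budgets, `(κ⋆−ε)M√Z√W ≤ J(v)` and finitely many
admissible local tests with pairwise disjoint supports, `Σᵢ locGain (κ⋆M) λ v φᵢ ≤ εM√Z√W`.  Port of the author's proof
(ns-idea-10 g9, line file REV 1.2): the joint field `v + Σφᵢ` is admissible of height `M` (disjoint supports), the gains add up
over the family (germ-locality), universality of `κ⋆` for the joint field and `lsi_abstract`. -/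
theorem localSlack_holds : LocalSlack := by
  intro v M B ε k φ hadm hZ hW hext hφ hdisj
  obtain ⟨hv, hdiv, hvM, hvB, h0, h1, h2⟩ := hadm
  -- disjointness bookkeeping
  have notMem : ∀ {x : E3} {i j : Fin k}, x ∈ tsupport (φ i) → j ≠ i → x ∉ tsupport (φ j) :=
    fun {x i j} hxi hji => Set.disjoint_left.1 (hdisj i j (Ne.symm hji)) hxi
  -- the joint perturbation
  set Φ : E3 → E3 := fun y => ∑ i, φ i y with hΦdef
  have hΦs : ContDiff ℝ (⊤ : ℕ∞) Φ := ContDiff.sum fun i _ => (hφ i).1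
  have hsub : tsupport Φ ⊆ ⋃ i, tsupport (φ i) := by
    refine closure_minimal (fun y hy => ?_) (isClosed_iUnion_of_finite fun i => isClosed_tsupport _)
    by_contra hcon
    simp only [Set.mem_iUnion, not_exists] at hcon
    exact hy (Finset.sum_eq_zero fun i _ => image_eq_zero_of_notMem_tsupport (hcon i))
  have hΦc : HasCompactSupport Φ :=
    (isCompact_iUnion fun i => (hφ i).2.1).of_isClosed_subset (isClosed_tsupport _) hsub
  -- germs of `Φ`: near a point of `tsupport (φ i)` it is `φ i`, elsewhere it is `0`
  have germB : ∀ {x : E3} {i : Fin k}, x ∈ tsupport (φ i) → Φ =ᶠ[𝓝 x] φ i := by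
    intro x i hxi
    have hall : ∀ᶠ y in 𝓝 x, ∀ j ∈ (Finset.univ.erase i), φ j y = 0 :=
      (Filter.eventually_all_finset _).2 fun j hj =>
        (notMem_tsupport_iff_eventuallyEq.1 (notMem hxi (Finset.ne_of_mem_erase hj))).mono fun y hy => hy
    refine hall.mono fun y hy => ?_
    show ∑ j, φ j y = φ i y
    rw [← Finset.add_sum_erase _ _ (Finset.mem_univ i), Finset.sum_eq_zero hy, add_zero]
  have germA : ∀ {x : E3}, (∀ i, x ∉ tsupport (φ i)) → Φ =ᶠ[𝓝 x] 0 := by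
    intro x hx
    refine notMem_tsupport_iff_eventuallyEq.1 fun hxΦ => ?_
    obtain ⟨i, hi⟩ := Set.mem_iUnion.1 (hsub hxΦ)
    exact hx i hi
  have valB : ∀ {x : E3} {i : Fin k}, x ∈ tsupport (φ i) → Φ x = φ i x := fun hxi => (germB hxi).self_of_nhds
  have valA : ∀ {x : E3}, (∀ i, x ∉ tsupport (φ i)) → Φ x = 0 := fun hx => (germA hx).self_of_nhds
  have hΦdiv : VectorCalculus.IsDivFree Φ := by
    intro x
    by_cases hB : ∃ i, x ∈ tsupport (φ i)
    · obtain ⟨i, hxi⟩ := hB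
      have h : VectorCalculus.divergence Φ x = VectorCalculus.divergence (φ i) x := by
        simp only [VectorCalculus.divergence, (germB hxi).fderiv_eq]
      rw [h]; exact (hφ i).2.2.1 x
    · push Not at hB
      have h : VectorCalculus.divergence Φ x = VectorCalculus.divergence (0 : E3 → E3) x := by
        simp only [VectorCalculus.divergence, (germA hB).fderiv_eq]
      rw [h]
      simp [VectorCalculus.divergence]
  -- the joint field is admissible of height `M`
  have hWeq : (fun y => v y + (1 : ℝ) • Φ y) = v + Φ := by funext y; simp
  have hadmW := KStar.admissible_add_smul hv hdiv hvB h0 h1 h2 hΦs hΦc hΦdiv (1 : ℝ)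
  rw [hWeq] at hadmW
  obtain ⟨hWs, hWdiv, ⟨B', hB'⟩, hW0, hW1, hW2⟩ := hadmW
  have hWM : ∀ x, ‖(v + Φ) x‖ ≤ M := by
    intro x
    by_cases hB : ∃ i, x ∈ tsupport (φ i)
    · obtain ⟨i, hxi⟩ := hB
      rw [Pi.add_apply, valB hxi]; exact (hφ i).2.2.2 x hxi
    · push Not at hB
      rw [Pi.add_apply, valA hB, add_zero]; exact hvM x
  have huniv := sharpDepletion_is_universal (v + Φ) M B' hWs hWdiv hWM hB' hW0 hW1 hW2
  have hJ' : Jst (v + Φ) ≤ kStar * M * Real.sqrt (Zen (v + Φ)) * Real.sqrt (Wpa (v + Φ)) :=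
    le_trans (le_abs_self _) huniv
  -- additivity of the gains over the disjoint family (the gain integrand of `Φ` is the sum of those of the `φ i`)
  have hpt : ∀ x, gainIntegrand (kStar * M) (lam v) v Φ x = ∑ i, gainIntegrand (kStar * M) (lam v) v (φ i) x := by
    intro x
    by_cases hB : ∃ i, x ∈ tsupport (φ i)
    · obtain ⟨i, hxi⟩ := hB
      have hg : (v + Φ) =ᶠ[𝓝 x] (v + φ i) :=
        (germB hxi).mono fun y hy => by simp only [Pi.add_apply, hy]
      rw [gainIntegrand_congr hg, Finset.sum_eq_single i
        (fun j _ hji => gainIntegrand_eq_zero (notMem hxi hji)) (fun h => (h (Finset.mem_univ i)).elim)]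
    · push Not at hB
      have hxΦ : x ∉ tsupport Φ := fun h => by
        obtain ⟨i, hi⟩ := Set.mem_iUnion.1 (hsub h); exact hB i hi
      rw [gainIntegrand_eq_zero hxΦ, Finset.sum_eq_zero fun i _ => gainIntegrand_eq_zero (hB i)]
  have hsum1 : ∑ i, locGain (kStar * M) (lam v) v (φ i) = ∫ x, gainIntegrand (kStar * M) (lam v) v Φ x := by
    simp_rw [locGain_eq_integral, hpt]
    exact (integral_finsetSum _ fun i _ => integrable_gainIntegrand hv (hφ i).1 (hφ i).2.1).symm
  -- splitting the joint gain into the six budgets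
  have isd : Integrable (sd v) := by unfold sd; exact KStar.integrable_stretching hv hvB h1
  have isd' : Integrable (sd (v + Φ)) := by unfold sd; exact KStar.integrable_stretching hWs hB' hW1
  have izd : Integrable (zd v) := by
    unfold zd; exact (integrable_norm_curl_sq (hv.of_le (by norm_cast)) h1).1
  have izd' : Integrable (zd (v + Φ)) := by
    unfold zd; exact (integrable_norm_curl_sq (hWs.of_le (by norm_cast)) hW1).1
  have iwd : Integrable (wd v) := by
    unfold wd; exact (integrable_frobeniusNormSq_fderiv_curl (hv.of_le (by norm_cast)) h2).1
  have iwd' : Integrable (wd (v + Φ)) := by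
    unfold wd; exact (integrable_frobeniusNormSq_fderiv_curl (hWs.of_le (by norm_cast)) hW2).1
  have hsplit : ∫ x, gainIntegrand (kStar * M) (lam v) v Φ x =
      (Jst (v + Φ) - Jst v) - (kStar * M) / 2 * ((lam v)⁻¹ * (Zen (v + Φ) - Zen v) + lam v * (Wpa (v + Φ) - Wpa v)) := by
    have iA : Integrable (fun x => sd (v + Φ) x - sd v x) := isd'.sub isd
    have iE : Integrable (fun x => (lam v)⁻¹ * (zd (v + Φ) x - zd v x)) := (izd'.sub izd).const_mul _
    have iH : Integrable (fun x => lam v * (wd (v + Φ) x - wd v x)) := (iwd'.sub iwd).const_mul _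
    have iEH : Integrable (fun x => (lam v)⁻¹ * (zd (v + Φ) x - zd v x) + lam v * (wd (v + Φ) x - wd v x)) := iE.add iH
    have iC : Integrable (fun x => (kStar * M) / 2 *
        ((lam v)⁻¹ * (zd (v + Φ) x - zd v x) + lam v * (wd (v + Φ) x - wd v x))) := iEH.const_mul _
    have e0 : (∫ x, gainIntegrand (kStar * M) (lam v) v Φ x) = ∫ x, ((sd (v + Φ) x - sd v x) - (kStar * M) / 2 *
        ((lam v)⁻¹ * (zd (v + Φ) x - zd v x) + lam v * (wd (v + Φ) x - wd v x))) := rfl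
    rw [e0, integral_sub iA iC, integral_sub isd' isd, integral_const_mul, integral_add iE iH, integral_const_mul,
      integral_const_mul, integral_sub izd' izd, integral_sub iwd' iwd]
    rfl
  -- the abstract tangent-plane inequality
  have hM0 : 0 ≤ M := (norm_nonneg _).trans (hvM 0)
  have hκM : 0 ≤ kStar * M := mul_nonneg kStar_pos.le hM0
  have hZ'0 : 0 ≤ Zen (v + Φ) := integral_nonneg fun x => sq_nonneg _
  have hW'0 : 0 ≤ Wpa (v + Φ) := integral_nonneg fun x => frobeniusNormSq_nonneg _
  have hu : 0 < Real.sqrt (Zen v) := Real.sqrt_pos.2 hZ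
  have hw : 0 < Real.sqrt (Wpa v) := Real.sqrt_pos.2 hW
  have key := lsi_abstract (J := Jst v) (J' := Jst (v + Φ)) (κ := kStar) (M := M) (ε := ε)
    (p := Real.sqrt (Zen (v + Φ))) (q := Real.sqrt (Wpa (v + Φ))) hu hw hκM hJ' hext
  rw [Real.sq_sqrt hZ'0, Real.sq_sqrt hZ.le, Real.sq_sqrt hW'0, Real.sq_sqrt hW.le] at key
  have hlam : lam v = Real.sqrt (Zen v) / Real.sqrt (Wpa v) := by
    unfold lam; exact Real.sqrt_div' (Zen v) hW.le
  rw [hsum1, hsplit, hlam, inv_div]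
  linarith [key]

/-! ## 4. The unconditional selection (L1 ∧ L2) -/

/-- **The thick-good-centre SELECTION holds unconditionally** (`Selection` = L2 with its slack hypothesis discharged by
L1): this is exactly what the line's L3 `Extraction` consumes. -/
theorem selection_holds : Selection := selection_of_localSlack localSlack_holds

end Summit.NavierStokesRegularity.NavierStokesRegularity.Theorems.NearExtremalTransiencePerFlow.LocalMaximiser

end
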